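import Summits.ResolutionOfSingularities.ResolutionOfSingularities.Theorems.DeltaCutLaw2B
import HarnessLib

/-!
# DeltaCutCells — decomp-res node «DeltaCut» (lens-6 g23, critic row 181 CLEARED DECIDED +1 · MAP +1 (lane (b))),
tree file 6/8 of the node

Content VERBATIM from the decomp-res lens-6 g23 node `HOME/decomp-res-lens-6/g23/DeltaCut.lean` (pin a85f83d5) /
`DeltaCutJ.lean` (9b3a0295); imports the
landed tree only, carries nothing; HOME = run/shared/lean/pub/decomp-res; critic row 181 CLEARED DECIDED +1 · MAP +1
(lane (b)); landing orders NODE-g23.md §10 /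
INBOX :883 — provenance, critic text and the lens header in full in the first file of the node, `DeltaCutLaw`.
Namespace `…Theorems.DeltaCutClasses`;
`--supports stmt-ResolutionOfSingularities-26971`; cone-free.

## This file

§CellsN — the cells (names as pre-priced, critic :814): locus `TopDeltaHeavy`; principal core
`WORTopHeavyPrincipalDeltaLight` (DECIDED) / `WORTopDeltaHeavyPrincipal` (RESIDUAL) / families; hyp-free carve
`worTopHeavyPrincipal_iff_deltaHeavy_deltaLight` / `e1TopHeavyPrincipal_iff_deltaHeavy_deltaLight`; DECIDED CHAIN
`worTopHeavyPrincipalDeltaLight_of_five`, `e1TopHeavyPrincipalDeltaLight_of_five (h5 : E 5)`; RE-LOCATION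
`e1TopHeavyPrincipal_iff_e1TopDeltaHeavyPrincipal (h5 : E 5)`, `e1TopHeavy_iff_nonPrincipal_deltaHeavy`; §CellsWhole
— the SAME carve of the WHOLE heavy cell (the law needs no principality): `WORTopHeavyDeltaLight` (DECIDED) /
`WORTopDeltaHeavy` (RESIDUAL) / families, **`E1TopDeltaHeavy`** (THE LOCATED RESIDUAL of the lens-6 column — base
data with a wild closed top point over which a NEAR POINT EXISTS; the route aside's HOME is this file), carve
`e1TopHeavy_iff_deltaHeavy_deltaLight`, decided `e1TopHeavyDeltaLight_of_five (h5 : E 5)`,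
**`e1TopHeavy_iff_e1TopDeltaHeavy (h5 : E 5) : E1TopHeavy ↔ E1TopDeltaHeavy`**,
`e1TopDeltaHeavyPrincipal_of_e1TopDeltaHeavy`; §Exactness — `exists_near_of_not_deltaLightAt`,
`not_noNearPointOver_of_not_deltaLightAt`, THE EXACT CRITERION **`noNearPointOver_iff_deltaLightAt`** (`Y` regular
locally Noetherian, `y` closed with `CharP (𝒪_y) p`, `M.mult = n ≥ 1`, `ord_y 𝓘 ≥ n`: `NoNearPointOver M y ↔
DeltaLightAt M.ideal n y` — NO principality, NO perfectness, NO hypersurface / dimension hypothesis), corollaries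
`deltaLightAt_of_lightAt`, `deltaLightAt_of_diffSplitAt`, CELL-LEVEL EXACTNESS **`topDeltaHeavy_iff_exists_near`**
(continued `…B` where the cap cuts).

[WRITER NOTE (decomp-res writer g11): file split only (tree files ≤ 400 lines); `noncomputable section`, universe,
namespace, sections, section
variables, the `open` lines and every declaration exactly as in the lens; no instance, no notation, no include/omit added.]

(Sources: Hironaka1967 (characteristic polyhedra); CossartJannsenSaito2020 Def. 3.13 / Thm. 3.14 p. 129, Ch. 8 pp.
128–135, Thm. 9.6 p. 136; Hironaka1970 (near points / vertices); CossartPiltant2008 §2; Giraud1975; EGAIV4 §16–§17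
(formal smoothness); StacksProject 0804 / 0BIQ / 031I; Matsumura1987 §28.)
-/

noncomputable section

open CategoryTheory CategoryTheory.Limits AlgebraicGeometry TopologicalSpace IsLocalRing
open Literature.AlgebraicGeometry.Resolution
universe u

open Summit.ResolutionOfSingularities.ResolutionOfSingularities.Theorems.TwistCutClasses
open Summit.ResolutionOfSingularities.ResolutionOfSingularities.Theorems.LightCutClasses

namespace Summit.ResolutionOfSingularities.ResolutionOfSingularities.Theorems.DeltaCutClasses

section CellsN

open Summit.ResolutionOfSingularities.ResolutionOfSingularities.Theorems
open WeakOrderReduction ForcedTowerClasses SubfieldContactClasses AbsoluteContactClasses PurityValveClasses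

/-! ### §R-c skeleton: TYPED CELLS of the δ-carve of the principal core, the EXACT (hypothesis-free) carve, the DECIDED chain -/

/-- **`TopDeltaHeavy Y 𝓘 n` — A δ-HEAVY WILD CLOSED TOP POINT EXISTS**: a closed point of order exactly `n`, without
absolute stalk
contact, NOT differentially split, NOT light and NOT δ-light. DEFINITION (residual locus of the δ-carve). -/
def TopDeltaHeavy (Y : Scheme.{0}) (I : Y.IdealSheafData) (n : ℕ) : Prop :=
  ∃ y : Y, IsClosed ({y} : Set Y) ∧ idealOrder I y = ((n : ℕ) : ℕ∞) ∧ ¬ IsAbsContactAt I n y ∧ ¬ DiffSplitAt I n y ∧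
    ¬ LightAt I n y ∧ ¬ DeltaLightAt I n y

/-- A δ-heavy point is a heavy point. [elementary] [folklore] -/
theorem topHeavy_of_topDeltaHeavy {Y : Scheme.{0}} {I : Y.IdealSheafData} {n : ℕ} (h : TopDeltaHeavy Y I n) :
    TopHeavy Y I n := by
  obtain ⟨y, hc, ho, hna, hns, hnl, -⟩ := h
  exact ⟨y, hc, ho, hna, hns, hnl⟩

/-- If NO δ-heavy wild closed top point exists, every wild closed top point is split ∨ light ∨ δ-light. [elementary]
[folklore] -/
theorem wild_splitOrLightOrDeltaLight_of_not_topDeltaHeavy {Y : Scheme.{0}} {M : MarkedIdeal Y} {n : ℕ}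
    (h : ¬ TopDeltaHeavy Y M.ideal n) :
    ∀ y ∈ wildSet M n, (DiffSplitAt M.ideal n y ∨ LightAt M.ideal n y) ∨ DeltaLightAt M.ideal n y := by
  intro y hy
  by_contra hc
  exact h ⟨y, hy.1, hy.2.1, hy.2.2, fun hs => hc (Or.inl (Or.inl hs)), fun hl => hc (Or.inl (Or.inr hl)),
    fun hd => hc (Or.inr hd)⟩

/-- **THE DECIDED CELL · `WORTopHeavyPrincipalDeltaLight n`** — the data of the principal heavy core
`WORTopHeavyPrincipal n` having
NO δ-heavy wild closed top point (every heavy point is δ-light). DECIDED (PROVED below from `SeqDimFour 5 n`). -/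
def WORTopHeavyPrincipalDeltaLight (n : ℕ) : Prop :=
  ∀ p : ℕ, p.Prime → ∀ (k : Type) [Field k] [CharP k p] (Y : Scheme.{0}) (g : Y ⟶ Spec (.of k)),
    IsBase Y g → ∀ M : MarkedIdeal Y, IsDatum n M → TopHeavy Y M.ideal n → ¬ TopHeavyNonPrincipal Y M.ideal n →
      ¬ TopDeltaHeavy Y M.ideal n → ∃ t : CentreSeq Y, WeakResolution t M

/-- **THE RESIDUAL CELL · `WORTopDeltaHeavyPrincipal n`** — the data of the principal heavy core having a δ-HEAVY
wild closed top
point (by `transform_mem_pow_iff_delta_heavy`: for every adapted presentation some prime of the directrix hyperplane is heavy at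
every layer — the honest «a near point can exist» locus). RESIDUAL. -/
def WORTopDeltaHeavyPrincipal (n : ℕ) : Prop :=
  ∀ p : ℕ, p.Prime → ∀ (k : Type) [Field k] [CharP k p] (Y : Scheme.{0}) (g : Y ⟶ Spec (.of k)),
    IsBase Y g → ∀ M : MarkedIdeal Y, IsDatum n M → TopHeavy Y M.ideal n → ¬ TopHeavyNonPrincipal Y M.ideal n →
      TopDeltaHeavy Y M.ideal n → ∃ t : CentreSeq Y, WeakResolution t M

/-- DECIDED (family). -/
def E1TopHeavyPrincipalDeltaLight : Prop := ∀ n : ℕ, 1 ≤ n → WORTopHeavyPrincipalDeltaLight n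

/-- RESIDUAL (family): THE LOCATED RESIDUAL of the δ-carve. -/
def E1TopDeltaHeavyPrincipal : Prop := ∀ n : ℕ, 1 ≤ n → WORTopDeltaHeavyPrincipal n

/-- **EXACT CARVE of the principal heavy core by δ** (hypothesis-free, excluded middle on `TopDeltaHeavy`).
[elementary] [folklore] -/
theorem worTopHeavyPrincipal_iff_deltaHeavy_deltaLight (n : ℕ) :
    WORTopHeavyPrincipal n ↔ WORTopDeltaHeavyPrincipal n ∧ WORTopHeavyPrincipalDeltaLight n := by
  constructor
  · intro h
    exact ⟨fun p hp k _ _ Y g hB M hM hH hNP _ => h p hp k Y g hB M hM hH hNP,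
      fun p hp k _ _ Y g hB M hM hH hNP _ => h p hp k Y g hB M hM hH hNP⟩
  · rintro ⟨hR, hD⟩ p hp k _ _ Y g hB M hM hH hNP
    by_cases hh : TopDeltaHeavy Y M.ideal n
    · exact hR p hp k Y g hB M hM hH hNP hh
    · exact hD p hp k Y g hB M hM hH hNP hh

/-- **EXACT CARVE (family)**: `E1TopHeavyPrincipal ⟺ E1TopDeltaHeavyPrincipal ∧ E1TopHeavyPrincipalDeltaLight`.
[elementary] [folklore] -/
theorem e1TopHeavyPrincipal_iff_deltaHeavy_deltaLight :
    E1TopHeavyPrincipal ↔ E1TopDeltaHeavyPrincipal ∧ E1TopHeavyPrincipalDeltaLight := by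
  constructor
  · intro h
    exact ⟨fun n hn => ((worTopHeavyPrincipal_iff_deltaHeavy_deltaLight n).1 (h n hn)).1,
      fun n hn => ((worTopHeavyPrincipal_iff_deltaHeavy_deltaLight n).1 (h n hn)).2⟩
  · rintro ⟨hR, hD⟩ n hn
    exact (worTopHeavyPrincipal_iff_deltaHeavy_deltaLight n).2 ⟨hR n hn, hD n hn⟩

/-- **THE DECIDED CELL IS PROVED** (kernel; ports discharged by the tree): `SeqDimFour 5 n → WORTopHeavyPrincipalDeltaLight n`.
[new] [folklore] -/
theorem worTopHeavyPrincipalDeltaLight_of_five {n : ℕ} (hn : 1 ≤ n) (h5 : SeqDimFour 5 n) :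
    WORTopHeavyPrincipalDeltaLight n :=
  fun p hp k _ _ Y g hB M hM _ _ hnd =>
    wor_of_splitOrLightOrDeltaLight hn h5 p hp k Y g hB M hM (wild_splitOrLightOrDeltaLight_of_not_topDeltaHeavy hnd)

/-- **THE DECIDED family under `E 5`.** [new] [folklore] -/
theorem e1TopHeavyPrincipalDeltaLight_of_five (h5 : E 5) : E1TopHeavyPrincipalDeltaLight :=
  fun n hn => worTopHeavyPrincipalDeltaLight_of_five hn (h5 n hn)

/-- **THE EXACT RE-LOCATION of the principal heavy core under `E 5`**: `E1TopHeavyPrincipal ⟺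
E1TopDeltaHeavyPrincipal`. [new] [folklore] -/
theorem e1TopHeavyPrincipal_iff_e1TopDeltaHeavyPrincipal (h5 : E 5) : E1TopHeavyPrincipal ↔ E1TopDeltaHeavyPrincipal :=
  ⟨fun h => (e1TopHeavyPrincipal_iff_deltaHeavy_deltaLight.1 h).1,
    fun h => e1TopHeavyPrincipal_iff_deltaHeavy_deltaLight.2 ⟨h, e1TopHeavyPrincipalDeltaLight_of_five h5⟩⟩

/-- **THE WHOLE HEAVY RESIDUAL re-located under `E 5`**: `E1TopHeavy ⟺ E1TopHeavyNonPrincipal ∧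
E1TopDeltaHeavyPrincipal`. [new] [folklore] -/
theorem e1TopHeavy_iff_nonPrincipal_deltaHeavy (h5 : E 5) :
    E1TopHeavy ↔ E1TopHeavyNonPrincipal ∧ E1TopDeltaHeavyPrincipal := by
  rw [e1TopHeavy_iff_nonPrincipal_principal, e1TopHeavyPrincipal_iff_e1TopDeltaHeavyPrincipal h5]

end CellsN

section CellsWhole

open Summit.ResolutionOfSingularities.ResolutionOfSingularities.Theorems
open WeakOrderReduction ForcedTowerClasses SubfieldContactClasses AbsoluteContactClasses PurityValveClasses

/-! ### THE WHOLE-CORE δ-CARVE (no principality needed any more: the ideal-level δ-law is exact for every stalk) -/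

/-- **THE DECIDED CELL · `WORTopHeavyDeltaLight n`** — heavy data (`TopHeavy`) having NO δ-heavy wild closed top point.
DECIDED (PROVED below from `SeqDimFour 5 n`). -/
def WORTopHeavyDeltaLight (n : ℕ) : Prop :=
  ∀ p : ℕ, p.Prime → ∀ (k : Type) [Field k] [CharP k p] (Y : Scheme.{0}) (g : Y ⟶ Spec (.of k)),
    IsBase Y g → ∀ M : MarkedIdeal Y, IsDatum n M → TopHeavy Y M.ideal n → ¬ TopDeltaHeavy Y M.ideal n →
      ∃ t : CentreSeq Y, WeakResolution t M

/-- **THE RESIDUAL CELL · `WORTopDeltaHeavy n`** — heavy data having a δ-HEAVY wild closed top point; by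
`topDeltaHeavy_iff_exists_near` this is EXACTLY «some wild closed top point has a near point over it». RESIDUAL. -/
def WORTopDeltaHeavy (n : ℕ) : Prop :=
  ∀ p : ℕ, p.Prime → ∀ (k : Type) [Field k] [CharP k p] (Y : Scheme.{0}) (g : Y ⟶ Spec (.of k)),
    IsBase Y g → ∀ M : MarkedIdeal Y, IsDatum n M → TopHeavy Y M.ideal n → TopDeltaHeavy Y M.ideal n →
      ∃ t : CentreSeq Y, WeakResolution t M

/-- DECIDED (family). -/
def E1TopHeavyDeltaLight : Prop := ∀ n : ℕ, 1 ≤ n → WORTopHeavyDeltaLight n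

/-- RESIDUAL (family): the whole heavy residual re-located into «a near point exists». -/
def E1TopDeltaHeavy : Prop := ∀ n : ℕ, 1 ≤ n → WORTopDeltaHeavy n

/-- **EXACT CARVE of the whole heavy cell by δ** (hypothesis-free, excluded middle on `TopDeltaHeavy`). [elementary]
[folklore] -/
theorem worTopHeavy_iff_deltaHeavy_deltaLight (n : ℕ) :
    WORTopHeavy n ↔ WORTopDeltaHeavy n ∧ WORTopHeavyDeltaLight n := by
  constructor
  · intro h
    exact ⟨fun p hp k _ _ Y g hB M hM hH _ => h p hp k Y g hB M hM hH,
      fun p hp k _ _ Y g hB M hM hH _ => h p hp k Y g hB M hM hH⟩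
  · rintro ⟨hR, hD⟩ p hp k _ _ Y g hB M hM hH
    by_cases hh : TopDeltaHeavy Y M.ideal n
    · exact hR p hp k Y g hB M hM hH hh
    · exact hD p hp k Y g hB M hM hH hh

/-- **EXACT CARVE (family)**: `E1TopHeavy ⟺ E1TopDeltaHeavy ∧ E1TopHeavyDeltaLight`. [elementary] [folklore] -/
theorem e1TopHeavy_iff_deltaHeavy_deltaLight : E1TopHeavy ↔ E1TopDeltaHeavy ∧ E1TopHeavyDeltaLight := by
  constructor
  · intro h
    exact ⟨fun n hn => ((worTopHeavy_iff_deltaHeavy_deltaLight n).1 (h n hn)).1,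
      fun n hn => ((worTopHeavy_iff_deltaHeavy_deltaLight n).1 (h n hn)).2⟩
  · rintro ⟨hR, hD⟩ n hn
    exact (worTopHeavy_iff_deltaHeavy_deltaLight n).2 ⟨hR n hn, hD n hn⟩

/-- **THE DECIDED CELL IS PROVED** (kernel): `SeqDimFour 5 n → WORTopHeavyDeltaLight n`. [new] [folklore] -/
theorem worTopHeavyDeltaLight_of_five {n : ℕ} (hn : 1 ≤ n) (h5 : SeqDimFour 5 n) : WORTopHeavyDeltaLight n :=
  fun p hp k _ _ Y g hB M hM _ hnd =>
    wor_of_splitOrLightOrDeltaLight hn h5 p hp k Y g hB M hM (wild_splitOrLightOrDeltaLight_of_not_topDeltaHeavy hnd)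

/-- **THE DECIDED family under `E 5`.** [new] [folklore] -/
theorem e1TopHeavyDeltaLight_of_five (h5 : E 5) : E1TopHeavyDeltaLight :=
  fun n hn => worTopHeavyDeltaLight_of_five hn (h5 n hn)

/-- **THE EXACT RE-LOCATION of the WHOLE heavy residual under `E 5`**: `E1TopHeavy ⟺ E1TopDeltaHeavy`. [new] [folklore] -/
theorem e1TopHeavy_iff_e1TopDeltaHeavy (h5 : E 5) : E1TopHeavy ↔ E1TopDeltaHeavy :=
  ⟨fun h => (e1TopHeavy_iff_deltaHeavy_deltaLight.1 h).1,
    fun h => e1TopHeavy_iff_deltaHeavy_deltaLight.2 ⟨h, e1TopHeavyDeltaLight_of_five h5⟩⟩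

/-- The principal-core residual is implied by the whole-core residual (same conclusion, more hypotheses).
[elementary] [folklore] -/
theorem e1TopDeltaHeavyPrincipal_of_e1TopDeltaHeavy (h : E1TopDeltaHeavy) : E1TopDeltaHeavyPrincipal :=
  fun n hn p hp k _ _ Y g hB M hM hH _ hd => h n hn p hp k Y g hB M hM hH hd

end CellsWhole

section Exactness

open Summit.ResolutionOfSingularities.ResolutionOfSingularities.Theorems
open WeakOrderReduction ForcedTowerClasses SubfieldContactClasses AbsoluteContactClasses PurityValveClasses
open Scheme.IdealSheafData (vanishingIdeal)

/-! ### EXACTNESS OF THE RE-LOCATION (kernel, both directions): at a closed point of order `≥ n` in characteristic `p`,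
«NOT δ-light» ⟺ «a near point EXISTS»; at cell level the residual locus `TopDeltaHeavy` IS «some wild closed top
point has a near point» -/

/-- **NOT δ-LIGHT ⟹ A NEAR POINT EXISTS, over EVERY point blow-up (kernel; the converse of `noNearPointOver_of_deltaLightAt`).**
`Y` regular, `y` a closed point whose local ring has prime characteristic `p`, `M` of multiplicity `n ≥ 1` with
`ord_y 𝓘 ≥ n` — NO
principality, NO perfectness.  If `𝓘_y` is not δ-light then for EVERY blow-up `π` of `Y` along a regular centre supported at `y`
some point `y'` over `y` lies in the support of the transform `(π^*𝓘 : 𝓔^n, n)`.  (A regular system of parameters exists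
(Literature `exists_extend_to_rsop`); a ring section exists (`exists_ring_section_of_charP`, from
`Literature.RingTheory.Smooth.formallySmooth_of_charP`); «not δ-light» then says some chart prime is δ-heavy for the whole stalk
ideal; `exists_near_of_delta_heavy` produces the near point.) [new] (Sources: CossartJannsenSaito2020, Thm 9.6.) -/
theorem exists_near_of_not_deltaLightAt {Y : Scheme.{0}} (hY : Scheme.IsRegular Y) {p : ℕ} [Fact p.Prime] {n : ℕ}
    (hn : 1 ≤ n) (M : MarkedIdeal Y) (hM : M.mult = n) {y : Y} (hyc : IsClosed ({y} : Set Y))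
    [CharP (Y.presheaf.stalk y) p] (hord : ((n : ℕ) : ℕ∞) ≤ idealOrder M.ideal y) (hnl : ¬ DeltaLightAt M.ideal n y) :
    ∀ (C : Y.IdealSheafData) (Y' : Scheme.{0}) (π : Y' ⟶ Y), (C.support : Set Y) = {y} →
      Scheme.IsRegular C.subscheme → IsBlowup π C → ∃ y' : Y', π.base y' = y ∧ y' ∈ (M.transform π C).support := by
  classical
  intro C Y' π hpt hCreg hπ
  haveI : IsRegularLocalRing (Y.presheaf.stalk y) := hY y
  have hIn : stalkIdeal M.ideal y ≤ maximalIdeal _ ^ n := (le_idealOrder_iff M.ideal y n).1 hord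
  -- (1) a regular system of parameters `c`
  obtain ⟨e, w, hdim, hzw⟩ := exists_extend_to_rsop (Fin.elim0 : Fin 0 → Y.presheaf.stalk y) (fun k => Fin.elim0 k)
    (fun _ _ k => Fin.elim0 k)
  obtain ⟨c, hcdef⟩ : ∃ c : Fin (0 + e) → Y.presheaf.stalk y, c = Fin.append (Fin.elim0 : Fin 0 → _) w := ⟨_, rfl⟩
  have hd : (maximalIdeal (Y.presheaf.stalk y)).spanFinrank = 0 + e := spanFinrank_eq_of_ringKrullDim_eq hdim
  have hc : Ideal.span (Set.range c) = maximalIdeal _ := by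
    rw [hcdef, span_range_append]; exact hzw
  -- (2) a ring section with adapted lifts (prime characteristic)
  obtain ⟨sbar, hsbar⟩ := exists_ring_section_of_charP (R := Y.presheaf.stalk y) p n hn
  -- (3) «not δ-light» ⟹ some chart prime is δ-heavy for the whole stalk ideal
  have hheavy : ∃ (i : Fin (0 + e)) (𝔮 : Ideal (MvPolynomial {j : Fin (0 + e) // j ≠ i} (ResidueField (Y.presheaf.stalk y)))),
      𝔮.IsPrime ∧ ∀ f ∈ stalkIdeal M.ideal y, ∀ (E : ℕ → Finset (Fin (0 + e) → ℕ))
        (b : ℕ → (Fin (0 + e) → ℕ) → Y.presheaf.stalk y),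
        (∀ k, ∀ e' ∈ E k, ∑ j, e' j = n + k) →
        (∀ k e', Ideal.Quotient.mk ((maximalIdeal (Y.presheaf.stalk y)) ^ n) (b k e') =
          sbar (residue (Y.presheaf.stalk y) (b k e'))) →
        f - ∑ k ∈ Finset.range n, ∑ e' ∈ E k, b k e' * ∏ j, c j ^ e' j ∈ maximalIdeal (Y.presheaf.stalk y) ^ (n + n) →
        ∀ k, k < n → ∃ s ∉ 𝔮,
          s * (∑ e' ∈ E k, MvPolynomial.monomial (restrictExp i e') (residue _ (b k e'))) ∈ 𝔮 ^ (n - k) := by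
    by_contra hcon
    push Not at hcon
    exact hnl ⟨0 + e, c, hd, hc, sbar, hsbar, hcon⟩
  obtain ⟨i, 𝔮, h𝔮p, hhv⟩ := hheavy
  haveI := h𝔮p
  -- (4) the converse law
  obtain ⟨y', hy', hle⟩ := exists_near_of_delta_heavy hπ hY hCreg M.ideal y hyc hpt c hd hc hn hIn sbar hsbar 𝔮 hhv
  refine ⟨y', hy', ?_⟩
  rw [MarkedIdeal.mem_support_iff, MarkedIdeal.transform_ideal, MarkedIdeal.transform_mult, hM]
  exact hle

/-- **NOT δ-LIGHT ⟹ NOT NEAR-POINT-FREE** (a point blow-up exists: Literature `exists_isBlowup`; the point centre is regular: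
`isRegular_subscheme_vanishingIdeal_singleton`). [new] [folklore] -/
theorem not_noNearPointOver_of_not_deltaLightAt {Y : Scheme.{0}} (hY : Scheme.IsRegular Y) [IsLocallyNoetherian Y] {p : ℕ}
    [Fact p.Prime] {n : ℕ} (hn : 1 ≤ n) (M : MarkedIdeal Y) (hM : M.mult = n) {y : Y} (hyc : IsClosed ({y} : Set Y))
    [CharP (Y.presheaf.stalk y) p] (hord : ((n : ℕ) : ℕ∞) ≤ idealOrder M.ideal y) (hnl : ¬ DeltaLightAt M.ideal n y) :
    ¬ NoNearPointOver M y := by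
  intro hno
  obtain ⟨Y', π, hπ⟩ := exists_isBlowup Y (vanishingIdeal ⟨{y}, hyc⟩)
  obtain ⟨y', hy', hmem⟩ := exists_near_of_not_deltaLightAt hY hn M hM hyc hord hnl _ Y' π
    (coe_support_vanishingIdeal_singleton hyc) (isRegular_subscheme_vanishingIdeal_singleton hyc) hπ
  exact hno _ Y' π (coe_support_vanishingIdeal_singleton hyc) (isRegular_subscheme_vanishingIdeal_singleton hyc) hπ y' hy'
    hmem

/-- **THE EXACT NEAR-POINT CRITERION (kernel, both directions; every stalk, no principality, no perfectness):** at a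
closed point
`y` of order `≥ n` of a regular locally Noetherian scheme whose local ring at `y` has prime characteristic,
`NoNearPointOver M y ⟺ DeltaLightAt 𝓘 n y` — «no near point over `y` (over any point blow-up)» iff «`𝓘_y` is
δ-light»; equivalently
«A NEAR POINT EXISTS» iff «some point of the exceptional divisor is δ-heavy for all of `𝓘_y`» — Hironaka's criterion `δ ≥ 1`
(Hironaka 1967; Cossart–Jannsen–Saito Thm 9.6; tree `CharPolyhedronDeltaPositive.deltaGE_one_pos_iff_forall_mem`,
`Hironaka1970NearPointVertices`) proved directly over the Rees charts for `MarkedIdeal` / `controlledTransform`.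
[new] (Sources: CossartJannsenSaito2020, Thm 9.6.) -/
theorem noNearPointOver_iff_deltaLightAt {Y : Scheme.{0}} (hY : Scheme.IsRegular Y) [IsLocallyNoetherian Y] {p : ℕ}
    [Fact p.Prime] {n : ℕ} (hn : 1 ≤ n) (M : MarkedIdeal Y) (hM : M.mult = n) {y : Y} (hyc : IsClosed ({y} : Set Y))
    [CharP (Y.presheaf.stalk y) p] (hord : ((n : ℕ) : ℕ∞) ≤ idealOrder M.ideal y) :
    NoNearPointOver M y ↔ DeltaLightAt M.ideal n y :=
  ⟨fun h => Classical.by_contradiction fun hnl => not_noNearPointOver_of_not_deltaLightAt hY hn M hM hyc hord hnl h,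
    noNearPointOver_of_deltaLightAt hY hn M hM hyc⟩

/-- **LIGHT ⟹ δ-LIGHT** (the second face is one of the faces): corollary of exactness and the tree's light law
`noNearPointOver_of_lightAt`. [new] [folklore] -/
theorem deltaLightAt_of_lightAt {Y : Scheme.{0}} (hY : Scheme.IsRegular Y) [IsLocallyNoetherian Y] {p : ℕ}
    [Fact p.Prime] {n : ℕ} (hn : 1 ≤ n) (M : MarkedIdeal Y) (hM : M.mult = n) {y : Y} (hyc : IsClosed ({y} : Set Y))
    [CharP (Y.presheaf.stalk y) p] (hord : ((n : ℕ) : ℕ∞) ≤ idealOrder M.ideal y) (hl : LightAt M.ideal n y) :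
    DeltaLightAt M.ideal n y :=
  (noNearPointOver_iff_deltaLightAt hY hn M hM hyc hord).1 (noNearPointOver_of_lightAt hY hn M hM hyc hl)

/-- **SPLIT ⟹ δ-LIGHT**: corollary of exactness and the tree's twist law `noNearPointOver_of_diffSplitAt`. [new] [folklore] -/
theorem deltaLightAt_of_diffSplitAt {Y : Scheme.{0}} (hY : Scheme.IsRegular Y) [IsLocallyNoetherian Y] {p : ℕ}
    [Fact p.Prime] {n : ℕ} (hn : 1 ≤ n) (M : MarkedIdeal Y) (hM : M.mult = n) {y : Y} (hyc : IsClosed ({y} : Set Y))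
    [CharP (Y.presheaf.stalk y) p] (hord : ((n : ℕ) : ℕ∞) ≤ idealOrder M.ideal y) (hs : DiffSplitAt M.ideal n y) :
    DeltaLightAt M.ideal n y :=
  (noNearPointOver_iff_deltaLightAt hY hn M hM hyc hord).1 (noNearPointOver_of_diffSplitAt hY hn M hM hyc hs)

/-- **CELL-LEVEL EXACTNESS — THE RESIDUAL LOCUS IS «A NEAR POINT EXISTS».**  In base data of characteristic `p` (`IsBase`,
`IsDatum n`): a δ-HEAVY wild closed top point exists (`TopDeltaHeavy`, the residual locus of the δ-carve) **iff** some wild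
closed top point (`wildSet M n`) has a near point over it (`¬ NoNearPointOver`).  No principality, no hypersurface hypothesis.
[new] [folklore] -/
theorem topDeltaHeavy_iff_exists_near {p : ℕ} (hp : p.Prime) {k : Type} [Field k] [CharP k p] {Y : Scheme.{0}}
    {g : Y ⟶ Spec (.of k)} (hB : IsBase Y g) {n : ℕ} (hn : 1 ≤ n) {M : MarkedIdeal Y} (hM : IsDatum n M) :
    TopDeltaHeavy Y M.ideal n ↔ ∃ y ∈ wildSet M n, ¬ NoNearPointOver M y := by
  haveI : Fact p.Prime := ⟨hp⟩
  haveI := hB.locallyOfFiniteType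
  haveI : IsLocallyNoetherian Y := LocallyOfFiniteType.isLocallyNoetherian g
  constructor
  · rintro ⟨y, hyc, hord, hna, hns, hnl, hnd⟩
    letI := stalkAlgebra (g.appTop.hom.comp (Scheme.ΓSpecIso (.of k)).inv.hom) y
    haveI : CharP (Y.presheaf.stalk y) p :=
      charP_of_injective_algebraMap (algebraMap k (Y.presheaf.stalk y)).injective p
    exact ⟨y, ⟨hyc, hord, hna⟩, not_noNearPointOver_of_not_deltaLightAt hB.isRegular hn M hM.1 hyc hord.ge hnd⟩
  · rintro ⟨y, hy, hnn⟩
    exact ⟨y, hy.1, hy.2.1, hy.2.2, fun hs => hnn (noNearPointOver_of_diffSplitAt hB.isRegular hn M hM.1 hy.1 hs),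
      fun hl => hnn (noNearPointOver_of_lightAt hB.isRegular hn M hM.1 hy.1 hl),
      fun hd => hnn (noNearPointOver_of_deltaLightAt hB.isRegular hn M hM.1 hy.1 hd)⟩

end Exactness

end Summit.ResolutionOfSingularities.ResolutionOfSingularities.Theorems.DeltaCutClasses
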